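import Literature.MathematicalPhysics.QuantumFieldTheory.Balaban1983to89.B8Prop5KLevelLetters

/-!
# `Balaban1983to89.B8LanF146` — THE INTERMEDIATE-LEVEL SOURCED GAUGE PREDICATE `LanF146` for [Balaban1985RegularSpaces] THEOREM 8 (p. 101):
# «`R_m(U₀)(D^{η*}_{U₀}A − f) = 0`» in multiplier form at every level `m`, + «`f ∈ R_k(U₀)`» at the top — the ONE reading of the free family
# `LanF` of `B8Thm4ConcreteLan ∕ B8Thm4CoreZd3Lan ∕ B8Thm8SurvivingZd3(H)` under which (i) the top level IS (1.146) `IsLandau146W` (`hLanF`),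
# (ii) the source `f = 0` gives back the un-sourced Landau predicate of record `IsLandau138W` at every level, and (iii) the sourced Prop.-5 fixed
# point (the JOIN with `W_λ ↦ W_λ − f`, seat `pub-ymgap-dag-n05-d` g5) DELIVERS it through the «WHY Z» bridge with one extra `−f`

statement-level skeleton of published theorems with citation tags; proofs where landed; nothing here is a claim about the Yang–Mills mass gap

T. Bałaban, *Spaces of regular gauge field configurations on a lattice and gauge fixing conditions*, Commun. Math. Phys. **99** (1985) 75–102
`[Balaban1985RegularSpaces]` ("B8"; journal page = PDF page + 74): (1.146) p. 101 «R(U₀)D^{η*}_{U₀}A = f … R(U₀)f = f», p. 101 «Inspecting the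
proofs of the above theorems …», (1.38) p. 82, (1.86)–(1.88) p. 91, (1.95) p. 92; [4] = T. Bałaban, *Propagators for lattice gauge theories in a
background field*, CMP **99** (1985) 389–434, (3.21)–(3.25) p. 394.

## WHY THIS FILE (cell `pub-ymgap`, HUMAN RULING D-0062; R134 seat `pub-ymgap-dag-n05-c` g5, DAG node N05 = [B8]; definition lane, count-neutral)

In Theorem 4's induction WITH SOURCE (print p. 101 «inspecting the proofs»), Proposition 5 is applied at each level `m + 1 ≤ k` to the truncated
structure `{Λ_0, …, Λ_m, Ω_{m+1}^{(m+1)}}`.  The typed (1.146) `B8Eq138LandauZd.IsLandau146 L m …` CONTAINS the membership «`f ∈ R_m(U₀)`»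
(`InR138 L m …`), and «`f ∈ R_k(U₀)`» does NOT imply «`f ∈ R_m(U₀)`» for `m < k` (the level-`m` truncation has MORE constraint blocks at level
`m`; located by `pub-ymgap-dag-n05-d` g5, INBOX 2026-08-27 l.16805).  But the induction never needs `f ∈ R_m`: what Proposition 5 produces and
[4] Theorem 3.3 consumes at level `m` is the PROJECTED equation `R_m(D^{η*}_{U₀}A′ − f) = 0`, i.e. the multiplier clause
`∃ μ, Δ^η_{U₀}↾Ω₀(D^{η*}_{U₀}A′ − f) = Q′_m(U₀)ᵀμ` on `Ω₀` — meaningful for EVERY `f`.  THIS FILE fixes that reading as the definition `LanF146` (the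
canonical instance of the free `LanF` of this seat's g4 chain), proves `hLanF` (top level = `IsLandau146W`), the `f = 0` consistency with the
un-sourced chain (`IsLandau138W` at every level), and the two SOURCED «WHY Z» bridges by which a sourced fixed point `λ = G′R(−Z′)`,
`Z′ + V_{λ′}(RZ′) = W_{λ′} − f`, delivers the level-`(m+1)` clause — n04-b's `B8Prop5KLevelLetters.multiplier_iff_of_whyZ` and
`isLandau138W_gaugeFixed_of_multiplier` with ONE extra `− f`.

## WHAT IS DECLARED ∕ PROVED (kernel, 0 sorry; axioms `propext` ∕ `Classical.choice` ∕ `Quot.sound`)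

* §1 **`LanF146 L k η Ω₀ Λs U₀ f m W`** (definition); `lanF146_top_iff` (`m = k`: `↔ IsLandau146W`), `lanF146_iff_of_lt` (`m < k`: the multiplier
  clause alone), `lanF146_zero_iff` (`f = 0`: `↔ IsLandau138W L m η Ω₀ (Λs m) U₀ W` at EVERY `m ≤ k`), `lanF146_mono_clause` (the clause is all a
  consumer below the top reads).
* §2 `dstar_rhs_sub_src_eq_Z_sub_RZ` (the D*-identity's right-hand side MINUS `f` equals `Z′ − RZ′` under the sourced Neumann equation),
  **`multiplier_iff_of_whyZ_src`**, **`multiplierSrc_gaugeFixed_of_multiplier`** (the clause for `U₁^{v⁻¹}`, `v = e^{iλ}`, from the multiplier form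
  of the JOIN's output), **`lanF146_gaugeFixed_of_multiplier`** (the whole `LanF146` at level `m`, the top membership passed through).

## HONEST SCOPE

A definition and algebraic bookkeeping (no estimate); the sourced fixed point itself is NOT constructed here (`pub-ymgap-dag-n05-d` g5 INTENT-4∕5,
`B8Prop5ContractionKLevelSrc`); nothing of [4] is asserted.  Count-neutral; N05 NOT discharged; `T_η ↦ ℤᵈ`; one finite `T⁴` programme at fixed `ε`,
Bałaban as printed — nothing continuum ∕ ℝ⁴ ∕ OS ∕ mass-gap ∕ Clay.  No `sorry`, no `instance`, no `notation`.  Unit `pub-ymgap-dag-n05-c` (g5), 2026-08-27.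

[cite: Balaban1985RegularSpaces, (1.146) p.101, p.101 («Inspecting the proofs»), (1.38) p.82, (1.86)–(1.88) p.91, (1.95) p.92, Thm 4 p.88;
Balaban1985BackgroundPropagators, (3.21)–(3.25) p.394]
-/

noncomputable section

open NormedSpace

namespace Literature.MathematicalPhysics.QuantumFieldTheory.Balaban1983to89.B8LanF146

open MatrixLog B7Prop1Explicit B7Prop2Explicit B7Eq92Concrete
open B7Eq78Linearization (conjR)
open B8Ineq132 (covDerivFwd covDeriv)
open B8Eq182Proof (gAd)
open B8Eq184Proof (gaugeExp cfgExp)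
open B8Eq188Proof (frakF3)
open B8Eq138LandauZd (covDivB covLap QT logCfg InR138 IsLandau138 IsLandau138W IsLandau146 IsLandau146W inR138_zero)
open B8Prop5KLevelLetters (dstar_rhs_eq_Z_sub_RZ multiplier_congr_on covDivB_logCfg_gaugeFixed)

-- `Site` alone could resolve to the torus sites of `Setup.lean`; re-export the `ℤ^d` sites of `B7Prop1Explicit`.
export B7Prop1Explicit (Site)

variable {d : ℕ} {𝔸 : Type*} [NormedRing 𝔸] [NormedAlgebra ℂ 𝔸] [NormOneClass 𝔸] [CompleteSpace 𝔸]

/-! ## §1 The predicate and its three faces -/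

section Def

/-- **`LanF146`: the level-`m` sourced gauge predicate of Theorem 4's induction WITH SOURCE** — the multiplier clause «`Δ^η_{U₀}↾Ω₀(D^{η*}_{U₀}A′ − f)
= Q′_m(U₀)ᵀμ` on `Ω₀` for some `μ`» (`R_m(U₀)(D^{η*}_{U₀}A′ − f) = 0`, `A′ = (1/iη) log W`), truncation structure `Λs m` at level `m`, AND at the top
level `m = k` the membership «`f ∈ R_k(U₀)`» (`InR138`), so that the top level is exactly (1.146) `IsLandau146W`.
[cite: Balaban1985RegularSpaces, (1.146) p.101, (1.38) p.82; Balaban1985BackgroundPropagators, (3.24)–(3.25) p.394] -/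
def LanF146 (L k : ℕ) (η : ℝ) (Ω₀ : Set (Site d)) (Λs : ℕ → ℕ → Set (Site d)) (U₀ : Site d → Fin d → 𝔸ˣ) (f : Site d → 𝔸) (m : ℕ)
    (W : Site d → Fin d → 𝔸ˣ) : Prop :=
  (∃ μ : ℕ → Site d → 𝔸, ∀ x ∈ Ω₀, covLap η U₀ (Ω₀.indicator (covDivB η U₀ (logCfg η W) - f)) x = QT L m (Λs m) U₀ μ x) ∧
    (m = k → InR138 L k η Ω₀ (Λs k) U₀ f)

variable (L k : ℕ) (η : ℝ) (Ω₀ : Set (Site d)) (Λs : ℕ → ℕ → Set (Site d)) (U₀ : Site d → Fin d → 𝔸ˣ)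

omit [NormOneClass 𝔸] in
/-- **TOP LEVEL = (1.146)**: `LanF146 … k W ↔ IsLandau146W L k η Ω₀ (Λs k) U₀ f W` — the `hLanF` binder of `B8Thm8SurvivingZd3(H).thm8SurvivingAt_zd3(H)_univ_lan`
and `B8Thm4CoreZd3Lan.thm4Core_zd3_lan` for the family `LanF i := LanF146 L i.k i.η (i.Ω 0) i.Λs`. [cite: Balaban1985RegularSpaces, (1.146) p.101] -/
theorem lanF146_top_iff (f : Site d → 𝔸) (W : Site d → Fin d → 𝔸ˣ) :
    LanF146 L k η Ω₀ Λs U₀ f k W ↔ IsLandau146W L k η Ω₀ (Λs k) U₀ f W :=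
  ⟨fun h => ⟨h.2 rfl, h.1⟩, fun h => ⟨h.2, fun _ => h.1⟩⟩

omit [NormOneClass 𝔸] in
/-- **BELOW THE TOP**: for `m ≠ k` the predicate IS the multiplier clause «`R_m(U₀)(D^{η*}A′ − f) = 0`» alone (no level-`m` membership of `f` is asked —
the located point «`f ∈ R_k ⇏ f ∈ R_m`»). [cite: Balaban1985RegularSpaces, (1.146) p.101, p.101 («Inspecting the proofs»)] -/
theorem lanF146_iff_of_ne {m : ℕ} (hm : m ≠ k) (f : Site d → 𝔸) (W : Site d → Fin d → 𝔸ˣ) :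
    LanF146 L k η Ω₀ Λs U₀ f m W ↔
      ∃ μ : ℕ → Site d → 𝔸, ∀ x ∈ Ω₀, covLap η U₀ (Ω₀.indicator (covDivB η U₀ (logCfg η W) - f)) x = QT L m (Λs m) U₀ μ x :=
  ⟨fun h => h.1, fun h => ⟨h, fun hmk => absurd hmk hm⟩⟩

omit [NormOneClass 𝔸] in
/-- The clause every consumer below the top reads. [cite: Balaban1985RegularSpaces, (1.146) p.101] -/
theorem lanF146_clause {f : Site d → 𝔸} {m : ℕ} {W : Site d → Fin d → 𝔸ˣ} (h : LanF146 L k η Ω₀ Λs U₀ f m W) :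
    ∃ μ : ℕ → Site d → 𝔸, ∀ x ∈ Ω₀, covLap η U₀ (Ω₀.indicator (covDivB η U₀ (logCfg η W) - f)) x = QT L m (Λs m) U₀ μ x :=
  h.1

omit [NormOneClass 𝔸] in
/-- **THE UN-SOURCED CHAIN IS THE CASE `f = 0`**: `LanF146 … 0 m W ↔ IsLandau138W L m η Ω₀ (Λs m) U₀ W` at EVERY level (`0 ∈ R_k(U₀)` by
`inR138_zero`) — so a sourced provider at `f = 0` serves the Landau predicate of record of `B8Thm4InductionLocal` ∕ `B8LeafModelZd3.thm4Printed_zd3`.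
[cite: Balaban1985RegularSpaces, (1.146) p.101, (1.38) p.82] -/
theorem lanF146_zero_iff (m : ℕ) (W : Site d → Fin d → 𝔸ˣ) :
    LanF146 L k η Ω₀ Λs U₀ (0 : Site d → 𝔸) m W ↔ IsLandau138W L m η Ω₀ (Λs m) U₀ W := by
  unfold LanF146 IsLandau138W IsLandau138
  simp only [sub_zero]
  exact ⟨fun h => h.1, fun h => ⟨h, fun _ => inR138_zero η L U₀ k Ω₀ (Λs k)⟩⟩

end Def

/-! ## §2 The SOURCED «WHY Z» bridges: from the sourced Neumann equation `Z′ + V(RZ′) = W − f` to the clause -/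

section WhyZSrc

omit [NormOneClass 𝔸] in
/-- **The D*-identity's right-hand side MINUS the source equals `Z′ − RZ′`** at a site `y` where `λ′ = λ − H_c`, `|λ′(y)| ≤ 1/12`, the sourced Neumann
equation `Z′(y) + (g(i ad_{λ′})RZ′ − RZ′)(y) = e^{−i ad λ′}D^{η*}A(y) − g(i ad_{λ′})ΔH_c(y) + Σ𝔉₃(y) − f(y)` and `Δλ(y) = −RZ′(y)` hold (n04-b's
`dstar_rhs_eq_Z_sub_RZ` at `Z := Z′ + f`). [cite: Balaban1985RegularSpaces, (1.88) p.91, (1.95) p.92, (1.146) p.101] -/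
theorem dstar_rhs_sub_src_eq_Z_sub_RZ {η : ℝ} (U₀ : Site d → Fin d → 𝔸ˣ) (A : Site d → Fin d → 𝔸) (f : Site d → 𝔸)
    {lam lam' Hc Z RZ : Site d → 𝔸} (hdef : lam' = lam - Hc) {y : Site d} (hl : ‖lam' y‖ ≤ 1 / 12)
    (hN : Z y + (gAd (RZ y) (lam' y) - RZ y) =
      conjR (gaugeExp lam' y)⁻¹ (covDivB η U₀ A y) - gAd (covLap η U₀ Hc y) (lam' y) + ∑ μ, frakF3 η U₀ lam' A y μ - f y)
    (hΔ : covLap η U₀ lam y = -RZ y) :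
    covDivB η U₀ A y + covLap η U₀ lam' y +
        ((conjR (gaugeExp lam' y)⁻¹ (covDivB η U₀ A y) - covDivB η U₀ A y) +
          (gAd (covLap η U₀ lam' y) (lam' y) - covLap η U₀ lam' y) + ∑ μ, frakF3 η U₀ lam' A y μ) - f y = Z y - RZ y := by
  have hN' : (Z + f) y + (gAd (RZ y) (lam' y) - RZ y) =
      conjR (gaugeExp lam' y)⁻¹ (covDivB η U₀ A y) - gAd (covLap η U₀ Hc y) (lam' y) + ∑ μ, frakF3 η U₀ lam' A y μ := by
    rw [Pi.add_apply, add_right_comm, hN]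
    abel
  rw [dstar_rhs_eq_Z_sub_RZ U₀ A hdef hl hN' hΔ, Pi.add_apply]
  abel

omit [NormOneClass 𝔸] in
/-- **`multiplier_iff_of_whyZ` WITH SOURCE**: under the sourced Neumann equation and `Δλ = −RZ′` on `Ω₀` (and `|λ′| ≤ 1/12` there), the multiplier clause
for the D*-identity's right-hand side MINUS `f` IS the clause `∃ μ, Δ^η_{U₀}↾Ω₀(Z′ − RZ′) = Q′ᵀμ` on `Ω₀` — which the projection law «`R(Z′ − RZ′) = 0`»
discharges exactly as in the un-sourced JOIN. [cite: Balaban1985RegularSpaces, (1.95)–(1.96) p.92, (1.146) p.101] -/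
theorem multiplier_iff_of_whyZ_src {η : ℝ} (L m : ℕ) (Ω₀ : Set (Site d)) (Λs : ℕ → Set (Site d)) (U₀ : Site d → Fin d → 𝔸ˣ)
    (A : Site d → Fin d → 𝔸) (f : Site d → 𝔸) {lam lam' Hc Z RZ : Site d → 𝔸} (hdef : lam' = lam - Hc) (hl : ∀ y ∈ Ω₀, ‖lam' y‖ ≤ 1 / 12)
    (hN : ∀ y ∈ Ω₀, Z y + (gAd (RZ y) (lam' y) - RZ y) =
      conjR (gaugeExp lam' y)⁻¹ (covDivB η U₀ A y) - gAd (covLap η U₀ Hc y) (lam' y) + ∑ μ, frakF3 η U₀ lam' A y μ - f y)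
    (hΔ : ∀ y ∈ Ω₀, covLap η U₀ lam y = -RZ y) :
    (∃ μ : ℕ → Site d → 𝔸, ∀ x ∈ Ω₀,
      covLap η U₀ (Ω₀.indicator fun y => covDivB η U₀ A y + covLap η U₀ lam' y +
        ((conjR (gaugeExp lam' y)⁻¹ (covDivB η U₀ A y) - covDivB η U₀ A y) +
          (gAd (covLap η U₀ lam' y) (lam' y) - covLap η U₀ lam' y) + ∑ μ, frakF3 η U₀ lam' A y μ) - f y) x = QT L m Λs U₀ μ x) ↔
      ∃ μ : ℕ → Site d → 𝔸, ∀ x ∈ Ω₀, covLap η U₀ (Ω₀.indicator (Z - RZ)) x = QT L m Λs U₀ μ x :=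
  multiplier_congr_on L m Ω₀ Λs U₀ fun y hy => by
    rw [Pi.sub_apply]
    exact dstar_rhs_sub_src_eq_Z_sub_RZ U₀ A f hdef (hl y hy) (hN y hy) (hΔ y hy)

/-- **The sourced clause transported to the gauge-fixed configuration**: if a fixed-point argument delivers `μ` with
`Δ^η_{U₀}↾Ω₀[D^{η*}_{U₀}A + Δλ + 𝔑(λ) − f] = Q′ᵀμ` on `Ω₀` and the smallness of `covDivB_logCfg_gaugeFixed` holds at every site of `Ω₀`, then `U₁^{v⁻¹}`,
`v = e^{iλ}`, satisfies «`R_m(U₀)(D^{η*}_{U₀}A′ − f) = 0`» in multiplier form, `A′ = (1/iη) log U₁^{v⁻¹}` (n04-b's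
`isLandau138W_gaugeFixed_of_multiplier` with one `− f`). [cite: Balaban1985RegularSpaces, (1.146) p.101, (1.86)–(1.88) p.91, (1.95) p.92] -/
theorem multiplierSrc_gaugeFixed_of_multiplier {η : ℝ} (hη : 0 < η) (L m : ℕ) (Ω₀ : Set (Site d)) (Λs : ℕ → Set (Site d))
    (U₀ : Site d → Fin d → 𝔸ˣ) {lam : Site d → 𝔸} (A : Site d → Fin d → 𝔸) (f : Site d → 𝔸)
    (hl : ∀ x ∈ Ω₀, ‖lam x‖ ≤ 1 / 12) (hD : ∀ x ∈ Ω₀, ∀ μ, η * ‖covDerivFwd η U₀ μ lam x‖ ≤ 1 / 70)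
    (ha : ∀ x ∈ Ω₀, ∀ μ, η * ‖covDeriv η U₀ μ lam x‖ ≤ 1 / 70)
    (hY : ∀ x ∈ Ω₀, ∀ μ, η * ‖conjR (U₀ (x - e μ) μ)⁻¹ (A (x - e μ) μ)‖ ≤ 1 / 12)
    (hmult : ∃ μ : ℕ → Site d → 𝔸, ∀ x ∈ Ω₀,
      covLap η U₀ (Ω₀.indicator fun y => covDivB η U₀ A y + covLap η U₀ lam y +
        ((conjR (gaugeExp lam y)⁻¹ (covDivB η U₀ A y) - covDivB η U₀ A y) +
          (gAd (covLap η U₀ lam y) (lam y) - covLap η U₀ lam y) + ∑ μ, frakF3 η U₀ lam A y μ) - f y) x = QT L m Λs U₀ μ x) :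
    ∃ μ : ℕ → Site d → 𝔸, ∀ x ∈ Ω₀,
      covLap η U₀ (Ω₀.indicator (covDivB η U₀ (logCfg η (mgauge U₀ (gaugeExp lam)⁻¹ (cfgExp η A))) - f)) x = QT L m Λs U₀ μ x := by
  obtain ⟨μ, hμ⟩ := hmult
  refine ⟨μ, fun x hx => ?_⟩
  have hind : Ω₀.indicator (covDivB η U₀ (logCfg η (mgauge U₀ (gaugeExp lam)⁻¹ (cfgExp η A))) - f) =
      Ω₀.indicator fun y => covDivB η U₀ A y + covLap η U₀ lam y +
        ((conjR (gaugeExp lam y)⁻¹ (covDivB η U₀ A y) - covDivB η U₀ A y) +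
          (gAd (covLap η U₀ lam y) (lam y) - covLap η U₀ lam y) + ∑ μ, frakF3 η U₀ lam A y μ) - f y := by
    refine Set.indicator_congr fun y hy => ?_
    rw [Pi.sub_apply, covDivB_logCfg_gaugeFixed hη U₀ A (hl y hy) (hD y hy) (ha y hy) (hY y hy)]
  rw [hind]
  exact hμ x hx

/-- **`LanF146` at level `m` for the gauge-fixed configuration** from the multiplier form of the sourced JOIN's output (+ the top membership
«`f ∈ R_k(U₀)`», passed through — it is a premiss of the sourced sockets). [cite: Balaban1985RegularSpaces, (1.146) p.101, (1.95) p.92] -/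
theorem lanF146_gaugeFixed_of_multiplier {η : ℝ} (hη : 0 < η) (L k m : ℕ) (Ω₀ : Set (Site d)) (Λs : ℕ → ℕ → Set (Site d))
    (U₀ : Site d → Fin d → 𝔸ˣ) {lam : Site d → 𝔸} (A : Site d → Fin d → 𝔸) (f : Site d → 𝔸)
    (hf : InR138 L k η Ω₀ (Λs k) U₀ f)
    (hl : ∀ x ∈ Ω₀, ‖lam x‖ ≤ 1 / 12) (hD : ∀ x ∈ Ω₀, ∀ μ, η * ‖covDerivFwd η U₀ μ lam x‖ ≤ 1 / 70)
    (ha : ∀ x ∈ Ω₀, ∀ μ, η * ‖covDeriv η U₀ μ lam x‖ ≤ 1 / 70)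
    (hY : ∀ x ∈ Ω₀, ∀ μ, η * ‖conjR (U₀ (x - e μ) μ)⁻¹ (A (x - e μ) μ)‖ ≤ 1 / 12)
    (hmult : ∃ μ : ℕ → Site d → 𝔸, ∀ x ∈ Ω₀,
      covLap η U₀ (Ω₀.indicator fun y => covDivB η U₀ A y + covLap η U₀ lam y +
        ((conjR (gaugeExp lam y)⁻¹ (covDivB η U₀ A y) - covDivB η U₀ A y) +
          (gAd (covLap η U₀ lam y) (lam y) - covLap η U₀ lam y) + ∑ μ, frakF3 η U₀ lam A y μ) - f y) x = QT L m (Λs m) U₀ μ x) :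
    LanF146 L k η Ω₀ Λs U₀ f m (mgauge U₀ (gaugeExp lam)⁻¹ (cfgExp η A)) :=
  ⟨multiplierSrc_gaugeFixed_of_multiplier hη L m Ω₀ (Λs m) U₀ A f hl hD ha hY hmult, fun _ => hf⟩

end WhyZSrc

#print axioms lanF146_gaugeFixed_of_multiplier

end Literature.MathematicalPhysics.QuantumFieldTheory.Balaban1983to89.B8LanF146

end
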